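import Summits.Ventures.PercRepro.RankLevelSetBiIndepAbsorbNormSkew
import Summits.Ventures.PercRepro.RankLevelSetPavingBases

/-! # RankLevelSetBiIndepAbsorbPaving — EVERY PAVING MATROID SATISFIES (ABS-norm) (night-1 g32; dossier §44.6)

In a paving matroid of rank `r` (every set with fewer than `r` elements is independent, `Paving M`) the absorbing
avoid-`x` profile `A^x_k = #{Z ∈ D_k : x ∉ Z, insert x Z dependent}` is supported on `{r − 1, r}` (`insert x Z` is a
dependent set of `k + 1 ≥ r` elements, `Z` is independent), and a member at level `k` has an independent complement
of `n − k ≤ r` elements (**`lowAbsorbAt_bounds_of_paving`**). So the only comparison of the full normalized half rule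
`NormSkew (A^x) n` that is not vacuous is the pair `(r − 1, r)` on `n = 2r − 1` elements, where the binomials agree and
the claim is `A^x_{r−1} ≤ A^x_r`: THE DEGREE ARGUMENT becomes g30's injection `depMap` — a bi-independent `(r − 1)`-set
`Z` absorbing `x` is sent to the base `Z ∪ {f}` avoiding `x` with `f ∉ cl (insert x Z)` (`isBase_depMap_of_mem`,
`depMap_mem_target`, `depMap_injOn` with `G = E`, `X = ∅`, `e = x`), whose complement has `r − 1` elements and is
independent by pavingness (**`ncard_lowAbsorbAt_le_of_paving`**). Hence **`absorbNormSkew_of_paving : Paving M →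
BiIndepAbsorbNormSkew M`** — the first proved class of g32's (ABS-norm), and through
`RankLevelSetBiIndepAbsorbNormSkew` the first proved class of g31's (★★)⁺ (`biIndepStarPlus_of_paving`) and, with Mono
of the contractions, of (STABLE) and of the parallel-pair one-circuit balance. Every declaration has a docstring;
imports: the cell's own modules and Mathlib only. Axioms: standard. -/

namespace PercRepro

open Set Matroid

variable {α : Type} (M : Matroid α) [M.Finite]

/-- **The support of the absorbing profile of a paving matroid**: a member of `lowAbsorbAt M x k` (`x ∈ E`) forces
`r ≤ k + 1`, `k ≤ r` and `#E ≤ k + r` (`r = rank`). -/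
lemma lowAbsorbAt_bounds_of_paving (h : Paving M) {r : ℕ} (hr : M.eRank = r) {x : α} (hx : x ∈ M.E) {k : ℕ}
    {Z : Set α} (hZ : Z ∈ lowAbsorbAt M x k) : r ≤ k + 1 ∧ k ≤ r ∧ M.E.ncard ≤ k + r := by
  obtain ⟨⟨hZE, hZcard, hZind, hZcind⟩, hxZ, hdep⟩ := hZ
  have hZfin : Z.Finite := M.ground_finite.subset hZE
  refine ⟨?_, ?_, ?_⟩
  · -- `insert x Z ⊆ E` is dependent, so it has at least `r` elements
    by_contra hlt
    apply hdep
    refine paving_indep_of_encard_lt M h (Set.insert_subset hx hZE) ?_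
    rw [Set.encard_insert_of_notMem hxZ, ← Set.Finite.cast_ncard_eq hZfin, hZcard, hr]
    exact_mod_cast (by omega : k + 1 < r)
  · have h1 := hZind.encard_le_eRank
    rw [← Set.Finite.cast_ncard_eq hZfin, hZcard, hr] at h1
    exact_mod_cast h1
  · have h1 := hZcind.encard_le_eRank
    rw [← Set.Finite.cast_ncard_eq (M.ground_finite.subset Set.sdiff_subset), Set.ncard_sdiff' hZE M.ground_finite,
      hZcard, hr] at h1
    have h2 : M.E.ncard - k ≤ r := by exact_mod_cast h1
    omega

/-- **The injection `Z ↦ Z ∪ {f}` from `A^x_{r−1}` into `A^x_r` on `n = 2r − 1` elements** (g30's `depMap` at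
`insert x Z`): the image is a base avoiding `x` whose complement (`r − 1` elements) is independent by pavingness. -/
theorem ncard_lowAbsorbAt_le_of_paving (h : Paving M) {r : ℕ} (hr : M.eRank = r) (hr1 : 1 ≤ r)
    (hn : M.E.ncard = 2 * r - 1) {x : α} (hx : x ∈ M.E) :
    (lowAbsorbAt M x (r - 1)).ncard ≤ (lowAbsorbAt M x r).ncard := by
  have hEr : M.eRk M.E = r := by rw [M.eRk_ground, hr]
  have hXr : (∅ : Set α).ncard + 1 ≤ r := by simp; omega
  refine Set.ncard_le_ncard_of_injOn (fun Z => depMap M M.E ∅ x (insert x Z)) ?_ ?_ (lowAbsorbAt_finite M x r)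
  · rintro Z ⟨⟨hZE, hZcard, hZind, hZcind⟩, hxZ, hdep⟩
    have hZfin : Z.Finite := M.ground_finite.subset hZE
    have hS : insert x Z ⊆ M.E := Set.insert_subset hx hZE
    have hScard : (insert x Z).ncard = r - (∅ : Set α).ncard := by
      rw [Set.ncard_insert_of_notMem hxZ hZfin, hZcard, Set.ncard_empty]; omega
    have hdep' : ¬ M.Indep (insert x Z ∪ ∅) := by rwa [Set.union_empty]
    have hxS : x ∈ insert x Z := Set.mem_insert x Z
    have hbase := isBase_depMap_of_mem M h hr (Set.Subset.refl M.E) hEr (Set.empty_subset M.E)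
      (Set.disjoint_empty M.E) x hS hScard hXr hdep' hxS
    rw [Set.union_empty] at hbase
    obtain ⟨hBsub, hBcard⟩ := depMap_mem_target M (Set.Subset.refl M.E) hEr (Set.empty_subset M.E)
      (Set.disjoint_empty M.E) x hS hScard hXr hdep'
    rw [Set.ncard_empty, Nat.sub_zero] at hBcard
    set B := depMap M M.E ∅ x (insert x Z) with hBdef
    have hBE : B ⊆ M.E := hBsub.trans Set.sdiff_subset
    have hxB : x ∉ B := fun hxB => (hBsub hxB).2 rfl
    refine ⟨⟨hBE, hBcard, hbase.indep, ?_⟩, hxB, ?_⟩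
    · refine paving_indep_of_ncard_lt M h hr Set.sdiff_subset ?_
      rw [Set.ncard_sdiff' hBE M.ground_finite, hBcard, hn]; omega
    · exact (hbase.insert_dep ⟨hx, hxB⟩).not_indep
  · rintro Z₁ ⟨⟨hZ₁E, hZ₁card, -, -⟩, hxZ₁, hdep₁⟩ Z₂ ⟨⟨hZ₂E, hZ₂card, -, -⟩, hxZ₂, hdep₂⟩ heq
    have hZ₁fin : Z₁.Finite := M.ground_finite.subset hZ₁E
    have hZ₂fin : Z₂.Finite := M.ground_finite.subset hZ₂E
    have hc₁ : (insert x Z₁).ncard = r - (∅ : Set α).ncard := by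
      rw [Set.ncard_insert_of_notMem hxZ₁ hZ₁fin, hZ₁card, Set.ncard_empty]; omega
    have hc₂ : (insert x Z₂).ncard = r - (∅ : Set α).ncard := by
      rw [Set.ncard_insert_of_notMem hxZ₂ hZ₂fin, hZ₂card, Set.ncard_empty]; omega
    have hd₁ : ¬ M.Indep (insert x Z₁ ∪ ∅) := by rwa [Set.union_empty]
    have hd₂ : ¬ M.Indep (insert x Z₂ ∪ ∅) := by rwa [Set.union_empty]
    have hS := depMap_injOn M h hr (Set.Subset.refl M.E) hEr (Set.empty_subset M.E) (Set.disjoint_empty M.E) x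
      (Set.insert_subset hx hZ₁E) (Set.insert_subset hx hZ₂E) hc₁ hc₂ hXr hd₁ hd₂ heq
    rw [← Set.insert_sdiff_self_of_notMem hxZ₁, ← Set.insert_sdiff_self_of_notMem hxZ₂, hS]

/-- **EVERY PAVING MATROID SATISFIES (ABS-norm)**: the profile is supported on `{r − 1, r}`, a member at level `k`
has `#E ≤ k + r`, so the only non-vacuous comparison is `(r − 1, r)` on `2r − 1` elements, with equal binomials,
and there `A^x_{r−1} ≤ A^x_r` by the injection. -/
theorem absorbNormSkew_of_paving (h : Paving M) : BiIndepAbsorbNormSkew M := by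
  intro x hx i j hij hR
  obtain ⟨r, hr⟩ : ∃ r : ℕ, M.eRank = r := by
    obtain ⟨k, hk⟩ := exists_eRk_eq_coe M M.E
    exact ⟨k, by rw [← M.eRk_ground]; exact hk⟩
  by_cases hAi : lowAbsorbCount M x i = 0
  · rw [hAi, Nat.zero_mul]; exact Nat.zero_le _
  · have hne : (lowAbsorbAt M x i).Nonempty := by
      by_contra hcon
      rw [Set.not_nonempty_iff_eq_empty] at hcon
      exact hAi (by unfold lowAbsorbCount; rw [hcon, Set.ncard_empty])
    obtain ⟨Z, hZ⟩ := hne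
    obtain ⟨h1, h2, h3⟩ := lowAbsorbAt_bounds_of_paving M h hr hx hZ
    have hj : j = r := by omega
    have hi : i = r - 1 := by omega
    have hn : M.E.ncard = 2 * r - 1 := by omega
    have hr1 : 1 ≤ r := by omega
    rw [hi, hj, hn]
    have hc : (2 * r - 1).choose r = (2 * r - 1).choose (r - 1) := by
      rw [← Nat.choose_symm (by omega : r - 1 ≤ 2 * r - 1)]
      congr 1; omega
    rw [hc]
    exact Nat.mul_le_mul_right _ (ncard_lowAbsorbAt_le_of_paving M h hr hr1 hn hx)

/-- **(★★)⁺ FOR EVERY PAVING MATROID.** -/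
theorem biIndepStarPlus_of_paving (h : Paving M) : BiIndepStarPlus M :=
  biIndepStarPlus_of_absorbNormSkew M (absorbNormSkew_of_paving M h)

end PercRepro
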